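import Summits.BirchSwinnertonDyer.BirchSwinnertonDyer.Theorems.ThetaPartnerAtTwoSignedMainConjectureCMTwoRankZeroLowerOffTwoColemanOntoTwo
import Summits.BirchSwinnertonDyer.BirchSwinnertonDyer.Theorems.ThetaPartnerAtTwoSignedControlAtTwoStubPlusHondaSystemTwo
import Literature.NumberTheory.EllipticCurves.CyclotomicZpExtensionLocalGeneratorProofs
import HarnessLib

/-!
# Route `ThetaPartnerAtTwo` (TP2), crux K2R0P♭ (stmt-BirchSwinnertonDyer-26471; derived node K2r0P stmt-BirchSwinnertonDyer-24945), line
# `rankzero` v16, stub (LDℓ)_A, clause (e): **the ♭ Coleman map at `2` is onto `Λ` — UNCONDITIONALLY** (HONDA⁺@2 supplied by the tree)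

HONEST FRAMING (cell `pub/bsd-wall`, W-ALL row 1; width seat `bsd-wall-tp2-p2-w2` g3, `--supports` only). THEOREMS ONLY — no definition,
no named fact, no instance, no `sorry`; route-independent (no `Theses`/`Cruxes` import); closes no item; a LOCAL statement at `p = 2` for
EVERY globally minimal `W/ℚ` with `GoodSS W 2`, `a₂ = 0` (CM or not); BSD is NOT proved by any of this.

`…LowerOffTwoColemanOntoTwo` (p617165) proved «every `f ∈ Λ` is a ♭-Coleman value» from a plus Honda system `d` with (L)(TR)(GEN₀) taken as
hypotheses. The tree PROVES HONDA⁺@2 (K4 `SignedControlAtTwo`, seats tp2-p3, tp2-p3-w2, tp2-p3-w3 with the K3 lead's points): at the model `ℚ_[2]`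
`SignedEC.PlusLayer.plusHondaSystemTwo_padic` (levels, trace relation, (GEN), non-divisibility of `d_0`; CM-agnostic), transported to
`(ℚ_v, closureEmb)` with (GEN₀) by `SignedEC.plusHondaSystem_adicCompletion_of_padic_nonDiv`. Feeding it in:

* `exists_plusHonda_flat_onto_two` — for every local `g` lifting a topological generator: SOME plus Honda system `d` at `v` ((L)(TR)(GEN)(GEN₀))
  has `Col♭_{g,d}` ONTO `Λ` (`∀ f, ∃ z Ls, IsColemanPair κ ι W 0 g d z Ls f`).
* `exists_localGenerator_plusHonda_flat_onto_two` — the same with `g` ∃-supplied (`ZpExtension.IsCyclotomic.exists_apply_resGalOfEmb_adicCompletion_eq`).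
So clause (e) of the LOWER package holds for the tree's own local data, with nothing assumed.

References: [Sprung2012] Thm. 2.2 (2′), Lemma 2.3 (p. 1487), Def. 5.9, 7.2, Prop. 7.3 (pp. 1495–1500); [Kobayashi2003] Thm. 6.2 (p. 11), §8.4
(Lemma 8.9, Props. 8.7, 8.11, 8.12); [KuriharaOtsuki2006] p. 557.
-/

set_option autoImplicit false
-- the Theorems namespace of this sub repeats the summit name by design (D-0017 nested layout)
set_option linter.dupNamespace false

noncomputable section

open scoped Classical NumberField

open NumberField IsDedekindDomain

namespace Summit.BirchSwinnertonDyer.BirchSwinnertonDyer.Theorems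

namespace SignedLowerOffTwo.ColemanOnto

open Literature.NumberTheory.EllipticCurves Literature.NumberTheory.GaloisRepresentations
  WeierstrassCurve ZpExtension Literature.NumberTheory.EllipticCurves.Kobayashi2003
  Literature.NumberTheory.EllipticCurves.Sprung2012 Literature.NumberTheory.EllipticCurves.Rank1Residual

variable (W : WeierstrassCurve ℚ) [W.IsElliptic] [W.IsGloballyMinimal] {κ : ZpExtension ℚ 2}
  (v : HeightOneSpectrum (𝓞 ℚ))

/-- **At `p = 2`, `Col♭` is ONTO `Λ` for the tree's plus Honda system — unconditionally.** For `W/ℚ` globally minimal with `GoodSS W 2`,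
`a₂ = 0`, cyclotomic `κ`, `v ∋ 2` and every local `g` restricting to a topological generator: there is a plus Honda system `d` at `v` with
(L) `d_m ∈ E(ℚ_{2,m}·ℚ_v)`, (TR) `Tr_{m+2/m+1} d_{m+2} = −d_m`, (GEN), (GEN₀), and EVERY `f ∈ Λ` is the ♭-Coleman value of some functional
(`IsColemanPair κ ι W 0 g d z Ls f`). HONDA⁺@2 = `SignedEC.PlusLayer.plusHondaSystemTwo_padic` + `SignedEC.plusHondaSystem_adicCompletion_of_padic_nonDiv`
(tree), surjectivity = `exists_isColemanPair_flat_eq_two`. [cite: Sprung2012, Prop. 7.3 (p. 1500), Thm. 2.2 (2′) (p. 1487)]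
[cite: Kobayashi2003, Thm. 6.2 (p. 11), Prop. 8.12 (p. 17)] -/
theorem exists_plusHonda_flat_onto_two (hss : GoodSS W 2) (ha : W.frobeniusTrace 2 = 0) (hκ : κ.IsCyclotomic)
    (hv : (2 : 𝓞 ℚ) ∈ v.asIdeal) {g : Field.absoluteGaloisGroup (v.adicCompletion ℚ)}
    (hg : κ.IsTopGenerator (resGalOfEmb (closureEmb (K := ℚ) (v.adicCompletion ℚ)) g)) :
    ∃ d : ℕ → localPoints W (v.adicCompletion ℚ),
      (∀ m, d m ∈ localLayerPoints κ (v.adicCompletion ℚ) W m) ∧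
      (∀ m, localTrace κ (v.adicCompletion ℚ) W (m + 1) (m + 2) (d (m + 2)) = -d m) ∧
      (∀ m : ℕ, 1 ≤ m → ∀ P ∈ localLayerPoints κ (v.adicCompletion ℚ) W m,
        ∃ B ∈ AddSubgroup.closure (Set.range fun σ : Field.absoluteGaloisGroup (v.adicCompletion ℚ) ↦ σ • d m),
          ∃ P' ∈ localLayerPoints κ (v.adicCompletion ℚ) W (m - 1), ∃ R ∈ localLayerPoints κ (v.adicCompletion ℚ) W m,
            P = B + P' + 2 • R) ∧
      (∀ P ∈ localLayerPoints κ (v.adicCompletion ℚ) W 0, ∃ a : ℤ, ∃ R ∈ localLayerPoints κ (v.adicCompletion ℚ) W 0,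
        P = a • d 0 + 2 • R) ∧
      ∀ f : IwasawaAlgebra 2, ∃ (z : localTowerPointsOfEmb κ (closureEmb (K := ℚ) (v.adicCompletion ℚ)) W →+ ℤ_[2])
        (Ls : IwasawaAlgebra 2), IsColemanPair κ (closureEmb (K := ℚ) (v.adicCompletion ℚ)) W 0 g d z Ls f := by
  obtain ⟨d, hd, htr, hgen, hgen0⟩ := SignedEC.plusHondaSystem_adicCompletion_of_padic_nonDiv W hss κ v hv
    fun ι ↦ SignedEC.PlusLayer.plusHondaSystemTwo_padic W hss ha κ hκ ι
  exact ⟨d, hd, htr, hgen, hgen0, exists_isColemanPair_flat_eq_two W κ v hss hv hg hd htr hgen0⟩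

/-- **The same with the local generator ∃-supplied** (`p` is totally ramified in `ℚ_∞`: some `g ∈ Γ_{ℚ_v}` restricts to a topological generator,
`ZpExtension.IsCyclotomic.exists_apply_resGalOfEmb_adicCompletion_eq`): at `p = 2`, for `W/ℚ` globally minimal with `GoodSS W 2`, `a₂ = 0`,
cyclotomic `κ`, `v ∋ 2`, there are `g` and a plus Honda system `d` with (L)(TR)(GEN)(GEN₀) for which `Col♭_{g,d}` is onto `Λ`.
[cite: Sprung2012, Prop. 7.3 (p. 1500)] [cite: Kobayashi2003, Thm. 6.2 (p. 11)] [cite: Washington1997, §13.1] -/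
theorem exists_localGenerator_plusHonda_flat_onto_two (hss : GoodSS W 2) (ha : W.frobeniusTrace 2 = 0) (hκ : κ.IsCyclotomic)
    (hv : (2 : 𝓞 ℚ) ∈ v.asIdeal) :
    ∃ (g : Field.absoluteGaloisGroup (v.adicCompletion ℚ))
      (_ : κ.IsTopGenerator (resGalOfEmb (closureEmb (K := ℚ) (v.adicCompletion ℚ)) g))
      (d : ℕ → localPoints W (v.adicCompletion ℚ)),
      (∀ m, d m ∈ localLayerPoints κ (v.adicCompletion ℚ) W m) ∧
      (∀ m, localTrace κ (v.adicCompletion ℚ) W (m + 1) (m + 2) (d (m + 2)) = -d m) ∧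
      (∀ m : ℕ, 1 ≤ m → ∀ P ∈ localLayerPoints κ (v.adicCompletion ℚ) W m,
        ∃ B ∈ AddSubgroup.closure (Set.range fun σ : Field.absoluteGaloisGroup (v.adicCompletion ℚ) ↦ σ • d m),
          ∃ P' ∈ localLayerPoints κ (v.adicCompletion ℚ) W (m - 1), ∃ R ∈ localLayerPoints κ (v.adicCompletion ℚ) W m,
            P = B + P' + 2 • R) ∧
      (∀ P ∈ localLayerPoints κ (v.adicCompletion ℚ) W 0, ∃ a : ℤ, ∃ R ∈ localLayerPoints κ (v.adicCompletion ℚ) W 0,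
        P = a • d 0 + 2 • R) ∧
      ∀ f : IwasawaAlgebra 2, ∃ (z : localTowerPointsOfEmb κ (closureEmb (K := ℚ) (v.adicCompletion ℚ)) W →+ ℤ_[2])
        (Ls : IwasawaAlgebra 2), IsColemanPair κ (closureEmb (K := ℚ) (v.adicCompletion ℚ)) W 0 g d z Ls f := by
  obtain ⟨g, hg⟩ := ZpExtension.IsCyclotomic.exists_apply_resGalOfEmb_adicCompletion_eq hκ v (by exact_mod_cast hv)
    (Multiplicative.ofAdd (1 : ℤ_[2]))
  exact ⟨g, hg, exists_plusHonda_flat_onto_two W v hss ha hκ hv hg⟩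

end SignedLowerOffTwo.ColemanOnto

end Summit.BirchSwinnertonDyer.BirchSwinnertonDyer.Theorems

end
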